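import Mathlib
import Summits.Ventures.PercRepro2.TypedMarkedSeriesDefs

/-!
# The inequality behind rule G — `o` of degree two between `a₃` and `b` (blind cell PercRepro2,
night-3 g14, 2026-08-27; `proofs/NIGHT3-CERT.md` §23.8)

Model G (`TypedMarkedSeriesStateG.lean`, written out in place) has the signature
`(c12, c1b, c13, c2b, c23, cb3)` over the marks `a₁, a₂, b, a₃`.  Its nine-term colouring sum is
NONNEGATIVE on every consistent signature triple (`identG_kl`, `decide`; 324–360 of the 3,375
triples positive, none negative — kit j268129).  Nothing here asserts anything about the original
lane.
-/

namespace Summit.Ventures.PercRepro2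

open UnionCluster

namespace CovForm

namespace MarkedSeries

open OneTyped TypedA3 Untouched

/-- The inequality for rule G, `e` of type `1`, `f` of type `1`. -/
theorem identG_11 : ∀ (c12 c1b c13 c2b c23 cb3 : Bool), consB c12 c1b c13 c2b c23 cb3 = true →
    ∀ (d12 d1b d13 d2b d23 db3 : Bool), consB d12 d1b d13 d2b d23 db3 = true →
    ∀ (e12 e1b e13 e2b e23 eb3 : Bool), consB e12 e1b e13 e2b e23 eb3 = true →
    0 ≤ S9 1 1 (fun p a => (c12 || (p && a && (c23 || c2b) && (c13 || c1b)), (p && (c13 || (p && a && c1b))) || (a && (c1b || (p && a && c13))), (p && (c23 || (p && a && c2b))) || (a && (c2b || (p && a && c23))), (c1b || (p && a && c13)), (c2b || (p && a && c23)), (c13 || (p && a && c1b)), (c23 || (p && a && c2b))))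
      (fun p a => (d12 || (p && a && (d23 || d2b) && (d13 || d1b)), (p && (d13 || (p && a && d1b))) || (a && (d1b || (p && a && d13))), (p && (d23 || (p && a && d2b))) || (a && (d2b || (p && a && d23))), (d1b || (p && a && d13)), (d2b || (p && a && d23)), (d13 || (p && a && d1b)), (d23 || (p && a && d2b))))
      (fun p a => (e12 || (p && a && (e23 || e2b) && (e13 || e1b)), (p && (e13 || (p && a && e1b))) || (a && (e1b || (p && a && e13))), (p && (e23 || (p && a && e2b))) || (a && (e2b || (p && a && e23))), (e1b || (p && a && e13)), (e2b || (p && a && e23)), (e13 || (p && a && e1b)), (e23 || (p && a && e2b)))) := by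
  decide +kernel

/-- The inequality for rule G, `e` of type `1`, `f` of type `2`. -/
theorem identG_12 : ∀ (c12 c1b c13 c2b c23 cb3 : Bool), consB c12 c1b c13 c2b c23 cb3 = true →
    ∀ (d12 d1b d13 d2b d23 db3 : Bool), consB d12 d1b d13 d2b d23 db3 = true →
    ∀ (e12 e1b e13 e2b e23 eb3 : Bool), consB e12 e1b e13 e2b e23 eb3 = true →
    0 ≤ S9 1 2 (fun p a => (c12 || (p && a && (c23 || c2b) && (c13 || c1b)), (p && (c13 || (p && a && c1b))) || (a && (c1b || (p && a && c13))), (p && (c23 || (p && a && c2b))) || (a && (c2b || (p && a && c23))), (c1b || (p && a && c13)), (c2b || (p && a && c23)), (c13 || (p && a && c1b)), (c23 || (p && a && c2b))))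
      (fun p a => (d12 || (p && a && (d23 || d2b) && (d13 || d1b)), (p && (d13 || (p && a && d1b))) || (a && (d1b || (p && a && d13))), (p && (d23 || (p && a && d2b))) || (a && (d2b || (p && a && d23))), (d1b || (p && a && d13)), (d2b || (p && a && d23)), (d13 || (p && a && d1b)), (d23 || (p && a && d2b))))
      (fun p a => (e12 || (p && a && (e23 || e2b) && (e13 || e1b)), (p && (e13 || (p && a && e1b))) || (a && (e1b || (p && a && e13))), (p && (e23 || (p && a && e2b))) || (a && (e2b || (p && a && e23))), (e1b || (p && a && e13)), (e2b || (p && a && e23)), (e13 || (p && a && e1b)), (e23 || (p && a && e2b)))) := by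
  decide +kernel

end MarkedSeries

end CovForm

end Summit.Ventures.PercRepro2
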